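import Summits.HodgeConjecture.HodgeConjecture.Theorems.F0P3GlobalPacket      -- (N) DEFS FILE 2 (F0P3a-p01 (g11), ★ p840909): `GlobalPacket`, `Mem`, `IsDiscrete`, `one`, `pair`, `one_eq_prod_of_subset`; FILE 1 `LocalPacketKit`
import HarnessLib

/-!
# (N) DEFS, FILE 2b — GLOBAL-PACKET RIDERS: the ramification set `ramFinset`, the e.v.p. family `evpAt` with its (P5) junk convention, and
# «the products `⟨1, π⟩ = ∏ ⟨1, π_v⟩`, `⟨ρ, π⟩ = ∏ ⟨ρ_v, π_v⟩` are well-defined» (Rogawski §13.3 p. 199 ¶2, p. 200, p. 201 l. 1)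

Cell `hodgecm-mathlib` (D-0151), F0∕P3 «U3-mult», crux H413 (`stmt-HodgeConjecture-24833`), route of record `HCCMUnconditional`.  LEAD F0P3a-plan (g9) T8-66 (B)
(deal), (N) lead pen F0P3a-p01 (g11) 05:01:42Z (naming + head tokens = FILE 3 census c70774ab T1 rows #7 #9 + the «well-defined» sentence of p. 201);
F0P2-p01 (g9) pen.  Same namespace as FILE 2 (`…Cruxes.H413.F0P3GlobalPacket`), new module (FILE 2 is append-only; this file carries two `def`s ⇒ definition
lane, box-before-file via B-typ03; `--supports stmt-HodgeConjecture-24833 --as helper`).  No instance, no notation, no named fact, no `sorry`; every decl has the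
explicit `(Pg : GlobalPacket 𝔩)` binder; kit-generic in the Hermitian form `H′`.
HONEST LABEL: HC_CM is proved only modulo the printed citations until rung 0 closes; this file proves no printed statement — it names two pieces of the spectral
tuple of letter K9-STF (`ramG`, `evpG`) over the posited kit and records the bookkeeping print calls «well-defined».

CONTENTS (head tokens (r1)–(r4) of the naming line):
* (r1) `GlobalPacket.ramFinset Pg` — THE FINITE SET OF PLACES WHERE `Π_v` CONTAINS NO UNRAMIFIED REPRESENTATION (p. 199 ¶2 «for almost all `v`»; the tuple's `ramG`),
  `mem_ramFinset_iff : v ∈ Pg.ramFinset ↔ ¬ (𝔩 v).unr (Pg.loc v)`, `unr_of_not_mem_ramFinset`.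
* (r2) `GlobalPacket.evpAt Pg v νG` — THE e.v.p. OF `Π` AT `v`: the kit's `evpPkt` of the unramified packet `Π_v` (★ FILE 1; = the normalised eigencharacter of
  `π_v⁰ = sph`, ★ `IrrClass.eigencharacter`), junk `0` at the finitely many ramified places (the tuple's `evpG`); `evpAt_of_unr` ∕ `evpAt_of_not_unr` and the
  (P5) convention `evpAt_of_not : ¬ (HasCompactSupport f ∧ IsLevel K_v f) → Pg.evpAt v νG f = 0` (★ `IrrClass.eigencharacter_of_not`) [§13.7 p. 206;
  CartierCorvallis1979 §IV.1].
* (r3) `GlobalPacket.one_eq_prod_of_mem` — for a MEMBER `π` of `Π` and a kit satisfying FILE 1's `UnramLaw` everywhere, `⟨1, π⟩ = ∏_{v ∈ S} ⟨1, π_v⟩` for a finite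
  `S ⊇ Pg.ramFinset` (print p. 201 l. 1 «the products are well-defined since `⟨1, π_v⟩ = 1` if `π_v` is unramified»); `pair_eq_prod_of_subset` (the `⟨ρ, ·⟩` twin
  of ★ FILE 2 `one_eq_prod_of_subset`) and `pair_eq_prod_of_mem` under `Pg.IsImageOf ρ` ((ℓ4) `⟨ρ_v, π_v⁰⟩ = 1`, p. 201 l. 1).
* (r4) one-line read-backs `IsDiscrete.exists_mem`, `Mem.mem_loc`, `Mem.eventually_eq_sph`, `Mem.finite_setOf_ne_sph` (the exceptional set of a member is finite).

References: [Rogawski1990] §13.3 p. 199 ¶2, p. 200, p. 201 l. 1–3; §13.7 p. 206.  [CartierCorvallis1979] §IV.1 Cor. 4.1.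
-/

set_option autoImplicit false
-- the mandated namespace repeats `HodgeConjecture.HodgeConjecture`, as in every `Theorems/*.lean` of this sub-problem
set_option linter.dupNamespace false

noncomputable section

open NumberField IsDedekindDomain MeasureTheory Filter
open scoped Matrix MatrixGroups

namespace Summit.HodgeConjecture.HodgeConjecture.Cruxes.H413.F0P3GlobalPacket

open Literature.NumberTheory Literature.NumberTheory.Automorphic Literature.NumberTheory.Automorphic.UnitaryGroup
open Literature.NumberTheory.Rogawski1990 Literature.NumberTheory.GaloisRepresentations
open Summit.HodgeConjecture.HodgeConjecture.Cruxes.H413.F0P3LocalPacketKit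
open Summit.HodgeConjecture.HodgeConjecture.Cruxes.H413.F0P3GlobalPacketDiscrete

variable {L : Type} [Field L] [NumberField L] [IsCMField L] {H' : Matrix (Fin 3) (Fin 3) L}
  {𝔩 : ∀ v : HeightOneSpectrum (𝓞 ↥(maximalRealSubfield L)), LocalPacketKit L H' v}

namespace GlobalPacket

/-! ## §1 (r1) The ramification set of a global packet [p. 199 ¶2] -/

/-- **`Π.ramFinset` — the finite set of finite places at which `Π_v` contains NO unramified representation** (p. 199 ¶2 «`Π_v` contains an unramified
representation `π_v⁰` for almost all finite `v`»; the spectral tuple's `ramG`). [cite: Rogawski1990, §13.3 p. 199 ¶2] -/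
def ramFinset (Pg : GlobalPacket 𝔩) : Finset (HeightOneSpectrum (𝓞 ↥(maximalRealSubfield L))) :=
  (Filter.eventually_cofinite.mp Pg.cofinite_unr).toFinset

/-- `v ∈ Π.ramFinset ↔ Π_v` is not unramified. [cite: Rogawski1990, §13.3 p. 199 ¶2] -/
theorem mem_ramFinset_iff (Pg : GlobalPacket 𝔩) (v : HeightOneSpectrum (𝓞 ↥(maximalRealSubfield L))) :
    v ∈ Pg.ramFinset ↔ ¬ (𝔩 v).unr (Pg.loc v) := by
  unfold ramFinset
  rw [Set.Finite.mem_toFinset]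
  rfl

/-- Off `Π.ramFinset` the local packet is unramified. [cite: Rogawski1990, §13.3 p. 199 ¶2] -/
theorem unr_of_not_mem_ramFinset (Pg : GlobalPacket 𝔩) {v : HeightOneSpectrum (𝓞 ↥(maximalRealSubfield L))} (hv : v ∉ Pg.ramFinset) :
    (𝔩 v).unr (Pg.loc v) := by
  by_contra h
  exact hv ((Pg.mem_ramFinset_iff v).2 h)

/-! ## §2 (r2) The e.v.p. family of a global packet and its (P5) junk convention [§13.7 p. 206; CartierCorvallis1979 §IV.1] -/

/-- **`Π.evpAt v νG` — the e.v.p. of `Π` at the finite place `v`**: the kit's `evpPkt νG (Π.loc v) h` (the normalised `K_v`-eigencharacter of the unramified member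
`π_v⁰`, ★ FILE 1 ∕ ★ `IrrClass.eigencharacter`) when `Π_v` is unramified, junk `0` at the finitely many ramified places (the spectral tuple's `evpG`).
[cite: Rogawski1990, §13.7 p. 206; §13.3 p. 199 ¶2] [cite: CartierCorvallis1979, §IV.1 Cor. 4.1] -/
def evpAt (Pg : GlobalPacket 𝔩) (v : HeightOneSpectrum (𝓞 ↥(maximalRealSubfield L))) [MeasurableSpace ((UnitaryGroup.cmDatum L 3 H').Local v)]
    (νG : Measure ((UnitaryGroup.cmDatum L 3 H').Local v)) : ((UnitaryGroup.cmDatum L 3 H').Local v → ℂ) → ℂ :=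
  fun f => @dite ℂ ((𝔩 v).unr (Pg.loc v)) (Classical.dec _) (fun h => (𝔩 v).evpPkt νG (Pg.loc v) h f) (fun _ => 0)

/-- At an unramified place, `Π.evpAt v νG` IS the kit's `evpPkt` of `Π_v`. [cite: Rogawski1990, §13.7 p. 206] -/
theorem evpAt_of_unr (Pg : GlobalPacket 𝔩) (v : HeightOneSpectrum (𝓞 ↥(maximalRealSubfield L))) [MeasurableSpace ((UnitaryGroup.cmDatum L 3 H').Local v)]
    (νG : Measure ((UnitaryGroup.cmDatum L 3 H').Local v)) (h : (𝔩 v).unr (Pg.loc v)) :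
    Pg.evpAt v νG = (𝔩 v).evpPkt νG (Pg.loc v) h := by
  funext f
  simp only [evpAt, dif_pos h]

/-- At an unramified place, unfolded to the eigencharacter of `π_v⁰ = sph`. [cite: Rogawski1990, §13.7 p. 206] [cite: CartierCorvallis1979, §IV.1 Cor. 4.1] -/
theorem evpAt_of_unr_eq_eigencharacter (Pg : GlobalPacket 𝔩) (v : HeightOneSpectrum (𝓞 ↥(maximalRealSubfield L)))
    [MeasurableSpace ((UnitaryGroup.cmDatum L 3 H').Local v)] (νG : Measure ((UnitaryGroup.cmDatum L 3 H').Local v)) (h : (𝔩 v).unr (Pg.loc v)) :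
    Pg.evpAt v νG = ((𝔩 v).sph (Pg.loc v) h).eigencharacter (cmLocalIntegralLevel L 3 H' v) νG := by
  rw [evpAt_of_unr Pg v νG h]
  rfl

/-- At a ramified place, `Π.evpAt v νG = 0` (junk). [cite: Rogawski1990, §13.3 p. 199 ¶2] -/
theorem evpAt_of_not_unr (Pg : GlobalPacket 𝔩) (v : HeightOneSpectrum (𝓞 ↥(maximalRealSubfield L)))
    [MeasurableSpace ((UnitaryGroup.cmDatum L 3 H').Local v)] (νG : Measure ((UnitaryGroup.cmDatum L 3 H').Local v)) (h : ¬ (𝔩 v).unr (Pg.loc v)) :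
    Pg.evpAt v νG = 0 := by
  funext f
  simp only [evpAt, dif_neg h, Pi.zero_apply]

/-- **(P5) JUNK CONVENTION**: `Π.evpAt v νG f = 0` unless `f` is compactly supported and `K_v`-bi-invariant (`K_v = cmLocalIntegralLevel L 3 H′ v`) — at an
unramified place by ★ `IrrClass.eigencharacter_of_not`, at a ramified place by the junk `0`. [cite: CartierCorvallis1979, §IV.1 Cor. 4.1] [cite: Rogawski1990, §13.7 p. 206] -/
theorem evpAt_of_not (Pg : GlobalPacket 𝔩) (v : HeightOneSpectrum (𝓞 ↥(maximalRealSubfield L))) [MeasurableSpace ((UnitaryGroup.cmDatum L 3 H').Local v)]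
    (νG : Measure ((UnitaryGroup.cmDatum L 3 H').Local v)) (f : (UnitaryGroup.cmDatum L 3 H').Local v → ℂ)
    (hf : ¬ (HasCompactSupport f ∧ IsLevel (cmLocalIntegralLevel L 3 H' v) f)) : Pg.evpAt v νG f = 0 := by
  by_cases h : (𝔩 v).unr (Pg.loc v)
  · rw [evpAt_of_unr_eq_eigencharacter Pg v νG h]
    exact IrrClass.eigencharacter_of_not _ _ _ hf
  · rw [evpAt_of_not_unr Pg v νG h]
    rfl

/-- The (P5) convention as the spectral tuple quantifies it (all `v f` at once, for a family of local measures). [cite: CartierCorvallis1979, §IV.1 Cor. 4.1] -/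
theorem evpConvention_evpAt (Pg : GlobalPacket 𝔩) [∀ v : HeightOneSpectrum (𝓞 ↥(maximalRealSubfield L)), MeasurableSpace ((UnitaryGroup.cmDatum L 3 H').Local v)]
    (νG : ∀ v : HeightOneSpectrum (𝓞 ↥(maximalRealSubfield L)), Measure ((UnitaryGroup.cmDatum L 3 H').Local v)) :
    ∀ (v : HeightOneSpectrum (𝓞 ↥(maximalRealSubfield L))) (f : (UnitaryGroup.cmDatum L 3 H').Local v → ℂ),
      ¬ (HasCompactSupport f ∧ IsLevel (cmLocalIntegralLevel L 3 H' v) f) → Pg.evpAt v (νG v) f = 0 :=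
  fun v f hf => evpAt_of_not Pg v (νG v) f hf

/-! ## §3 (r4) Members and discreteness: one-line read-backs [p. 199 ¶2] -/

/-- A discrete packet has a member. [cite: Rogawski1990, §13.3 p. 199 ¶2] -/
theorem IsDiscrete.exists_mem {Pg : GlobalPacket 𝔩}
    {μ : Measure (adelicGroupData (↥(maximalRealSubfield L)) L (IsCMField.complexConj L) 3 H').automorphicQuotient}
    [SMulInvariantMeasure (adelicGroupData (↥(maximalRealSubfield L)) L (IsCMField.complexConj L) 3 H').Adelic
      (adelicGroupData (↥(maximalRealSubfield L)) L (IsCMField.complexConj L) 3 H').automorphicQuotient μ]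
    (h : Pg.IsDiscrete μ) :
    ∃ π : ∀ v : HeightOneSpectrum (𝓞 ↥(maximalRealSubfield L)), IrrClass ((UnitaryGroup.cmDatum L 3 H').Local v),
      Pg.Mem π ∧ cmOccursInDiscreteSpectrum L 3 H' μ π :=
  h

/-- A member lies in `Π_v` at every place. [cite: Rogawski1990, §13.3 p. 199 ¶2] -/
theorem Mem.mem_loc {Pg : GlobalPacket 𝔩}
    {π : ∀ v : HeightOneSpectrum (𝓞 ↥(maximalRealSubfield L)), IrrClass ((UnitaryGroup.cmDatum L 3 H').Local v)} (hπ : Pg.Mem π)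
    (v : HeightOneSpectrum (𝓞 ↥(maximalRealSubfield L))) : π v ∈ (𝔩 v).mem (Pg.loc v) :=
  hπ.1 v

/-- A member is the unramified representative `π_v⁰` at almost every place. [cite: Rogawski1990, §13.3 p. 199 ¶2] -/
theorem Mem.eventually_eq_sph {Pg : GlobalPacket 𝔩}
    {π : ∀ v : HeightOneSpectrum (𝓞 ↥(maximalRealSubfield L)), IrrClass ((UnitaryGroup.cmDatum L 3 H').Local v)} (hπ : Pg.Mem π) :
    ∀ᶠ v in cofinite, ∃ h : (𝔩 v).unr (Pg.loc v), π v = (𝔩 v).sph (Pg.loc v) h :=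
  hπ.2

/-- The exceptional set of a member — the places where `π_v` is NOT the unramified `π_v⁰` — is finite. [cite: Rogawski1990, §13.3 p. 199 ¶2] -/
theorem Mem.finite_setOf_ne_sph {Pg : GlobalPacket 𝔩}
    {π : ∀ v : HeightOneSpectrum (𝓞 ↥(maximalRealSubfield L)), IrrClass ((UnitaryGroup.cmDatum L 3 H').Local v)} (hπ : Pg.Mem π) :
    {v : HeightOneSpectrum (𝓞 ↥(maximalRealSubfield L)) | ¬ ∃ h : (𝔩 v).unr (Pg.loc v), π v = (𝔩 v).sph (Pg.loc v) h}.Finite :=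
  Filter.eventually_cofinite.mp hπ.2

/-- The ramification set of `Π` lies inside the exceptional set of any member. [cite: Rogawski1990, §13.3 p. 199 ¶2] -/
theorem Mem.ramFinset_subset_toFinset {Pg : GlobalPacket 𝔩}
    {π : ∀ v : HeightOneSpectrum (𝓞 ↥(maximalRealSubfield L)), IrrClass ((UnitaryGroup.cmDatum L 3 H').Local v)} (hπ : Pg.Mem π) :
    Pg.ramFinset ⊆ hπ.finite_setOf_ne_sph.toFinset := by
  intro v hv
  rw [Set.Finite.mem_toFinset]
  rintro ⟨h, -⟩
  exact (Pg.mem_ramFinset_iff v).1 hv h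

/-! ## §4 (r3) «The products are well-defined» [p. 200 last display; p. 201 l. 1] -/

/-- **`⟨ρ, π⟩ = 1` off a finite set**: if `⟨ρ_v, π_v⟩ = 1` for all `v ∉ S` then `⟨ρ, π⟩ = ∏_{v ∈ S} ⟨ρ_v, π_v⟩` (the `⟨ρ, ·⟩` twin of ★ FILE 2
`one_eq_prod_of_subset`). [cite: Rogawski1990, §13.3 p. 200, p. 201 l. 1] -/
theorem pair_eq_prod_of_subset (ρ : GlobalPacketH 𝔩)
    (π : ∀ v : HeightOneSpectrum (𝓞 ↥(maximalRealSubfield L)), IrrClass ((UnitaryGroup.cmDatum L 3 H').Local v))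
    (S : Finset (HeightOneSpectrum (𝓞 ↥(maximalRealSubfield L))))
    (hS : ∀ v, v ∉ S → (𝔩 v).pair (ρ.loc v) (π v) = 1) :
    GlobalPacket.pair ρ π = ∏ v ∈ S, (𝔩 v).pair (ρ.loc v) (π v) := by
  unfold GlobalPacket.pair
  exact finprod_eq_prod_of_mulSupport_subset _ (fun v hv => by
    by_contra h
    exact hv (hS v (by simpa using h)))

/-- **`⟨1, π⟩ IS A FINITE PRODUCT FOR A MEMBER** (p. 201 l. 1 «the products are well-defined since `⟨1, π_v⟩ = 1` if `π_v` is unramified»): for `π ∈ Π` and a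
kit satisfying FILE 1's `UnramLaw` at every place, `⟨1, π⟩ = ∏_{v ∈ S} ⟨1, π_v⟩` with `S` the (finite) exceptional set of `π`, which contains `Π.ramFinset`.
[cite: Rogawski1990, §13.3 p. 201 l. 1–3] -/
theorem one_eq_prod_of_mem (Pg : GlobalPacket 𝔩) (h𝔩 : ∀ v : HeightOneSpectrum (𝓞 ↥(maximalRealSubfield L)), (𝔩 v).UnramLaw)
    {π : ∀ v : HeightOneSpectrum (𝓞 ↥(maximalRealSubfield L)), IrrClass ((UnitaryGroup.cmDatum L 3 H').Local v)} (hπ : Pg.Mem π) :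
    ∃ S : Finset (HeightOneSpectrum (𝓞 ↥(maximalRealSubfield L))), Pg.ramFinset ⊆ S ∧ Pg.one π = ∏ v ∈ S, (𝔩 v).one (Pg.loc v) (π v) := by
  refine ⟨hπ.finite_setOf_ne_sph.toFinset, hπ.ramFinset_subset_toFinset, Pg.one_eq_prod_of_subset π _ fun v hv => ?_⟩
  rw [Set.Finite.mem_toFinset, Set.mem_setOf_eq, not_not] at hv
  obtain ⟨h, hπv⟩ := hv
  rw [hπv]
  exact (LocalPacketKit.UnramLaw.sph_mem_and_one (𝔩 v) (h𝔩 v) (Pg.loc v) h).2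

/-- **`⟨ρ, π⟩ IS A FINITE PRODUCT FOR A MEMBER OF `Π = Π(ρ)`** (p. 201 l. 1 «… `⟨ρ_v, π_v⟩ = 1` if `π_v` is unramified»): for `π ∈ Π`, `Π = ξ_H(ρ)` placewise
(`Pg.IsImageOf ρ`) and a kit satisfying `UnramLaw` everywhere, `⟨ρ, π⟩ = ∏_{v ∈ S} ⟨ρ_v, π_v⟩` with `S ⊇ Π.ramFinset` the exceptional set of `π`.
[cite: Rogawski1990, §13.3 p. 200, p. 201 l. 1–3] -/
theorem pair_eq_prod_of_mem (Pg : GlobalPacket 𝔩) (h𝔩 : ∀ v : HeightOneSpectrum (𝓞 ↥(maximalRealSubfield L)), (𝔩 v).UnramLaw)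
    (ρ : GlobalPacketH 𝔩) (hρ : Pg.IsImageOf ρ)
    {π : ∀ v : HeightOneSpectrum (𝓞 ↥(maximalRealSubfield L)), IrrClass ((UnitaryGroup.cmDatum L 3 H').Local v)} (hπ : Pg.Mem π) :
    ∃ S : Finset (HeightOneSpectrum (𝓞 ↥(maximalRealSubfield L))), Pg.ramFinset ⊆ S ∧
      GlobalPacket.pair ρ π = ∏ v ∈ S, (𝔩 v).pair (ρ.loc v) (π v) := by
  refine ⟨hπ.finite_setOf_ne_sph.toFinset, hπ.ramFinset_subset_toFinset, pair_eq_prod_of_subset ρ π _ fun v hv => ?_⟩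
  rw [Set.Finite.mem_toFinset, Set.mem_setOf_eq, not_not] at hv
  obtain ⟨h, hπv⟩ := hv
  rw [hπv]
  exact (h𝔩 v (Pg.loc v) h).2.2.2.2 (ρ.loc v) (hρ v)

end GlobalPacket

end Summit.HodgeConjecture.HodgeConjecture.Cruxes.H413.F0P3GlobalPacket

end
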